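import Mathlib
import Summits.Ventures.PercRepro2.TypedDomainInstanceH1
import Summits.Ventures.PercRepro2.TypedBundleSepTwo

/-!
# p3 g7's (HARRIS-1) instance, II: it lies in the sixteen-condition domain (blind cell PercRepro2,
p2 g7, 2026-08-26; the lead's RULING 1 of 00:44:30Z — «hand-checked, the lead / p2 to confirm in
Lean»)

On `endsH1` (TypedDomainInstanceH1.lean) the four separator conditions of the domain of record
hold — the path `o–u–b` meets no door pair of (SEP-3) (either way) nor of (SEP-2), the path
`o–u–a₁` no door pair of the `{a₃, b}`-pocket — so **`instanceH1_mem`**: the instance satisfies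
all sixteen conditions of `ResidualCoreNHatCTBRASUDO7SP2`; the announced o-pocket class on the
doors `{a₁, b}` meets the sixteen-condition domain of record and its class theorem subtracts a
non-empty part of it.  Own code; standard axioms.
-/

namespace Summit.Ventures.PercRepro2

open UnionCluster

namespace CovForm

namespace TypedRed

namespace NonVacuityH1

open Separated (zF)
open NonVacuity (ends_mem_of_within)

/-! ## The separator classes: the path `o–u–b` meets no door pair of (SEP-3) / (SEP-2), the path
`o–u–a₁` no door pair of the `{a₃, b}`-pocket -/

/-- No separator `{a₁, a₃}` between `o` and `{a₂, b}`: the edge `o–u` puts `u` on `o`'s side, and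
`u–b` would put `b` or `u` on both sides. -/
theorem noSepThreeH1 : ¬ SepThree.HasSepThree endsH1 0 1 2 3 4 FH1 := by
  rintro ⟨WO, WB, hs⟩
  have hoB : (0 : Fin 9) ∉ WB := fun h => by
    rcases hs.cap 0 hs.oO h with h1 | h3
    · exact absurd h1 (by decide)
    · exact absurd h3 (by decide)
  have e0 := hs.split 0 (zFH1 0)
  have huO : (5 : Fin 9) ∈ WO := by
    rcases e0 with w | w
    · exact (ends_mem_of_within (x := 0) (y := 5) rfl w).2
    · exact absurd (ends_mem_of_within (x := 0) (y := 5) rfl w).1 hoB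
  have e4 := hs.split 4 (zFH1 4)
  rcases e4 with w | w
  · have hbO := (ends_mem_of_within (x := 5) (y := 4) rfl w).2
    rcases hs.cap 4 hbO hs.bB with h | h <;> exact absurd h (by decide)
  · have huB := (ends_mem_of_within (x := 5) (y := 4) rfl w).1
    rcases hs.cap 5 huO huB with h | h <;> exact absurd h (by decide)

/-- No separator `{a₂, a₃}` between `o` and `{a₁, b}` (the mirror): the same path `o–u–b`. -/
theorem noSepThreeMirrorH1 : ¬ SepThree.HasSepThree endsH1 0 2 1 3 4 FH1 := by
  rintro ⟨WO, WB, hs⟩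
  have hoB : (0 : Fin 9) ∉ WB := fun h => by
    rcases hs.cap 0 hs.oO h with h1 | h3
    · exact absurd h1 (by decide)
    · exact absurd h3 (by decide)
  have e0 := hs.split 0 (zFH1 0)
  have huO : (5 : Fin 9) ∈ WO := by
    rcases e0 with w | w
    · exact (ends_mem_of_within (x := 0) (y := 5) rfl w).2
    · exact absurd (ends_mem_of_within (x := 0) (y := 5) rfl w).1 hoB
  have e4 := hs.split 4 (zFH1 4)
  rcases e4 with w | w
  · have hbO := (ends_mem_of_within (x := 5) (y := 4) rfl w).2
    rcases hs.cap 4 hbO hs.bB with h | h <;> exact absurd h (by decide)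
  · have huB := (ends_mem_of_within (x := 5) (y := 4) rfl w).1
    rcases hs.cap 5 huO huB with h | h <;> exact absurd h (by decide)

/-- No `{a₃, b}`-pocket: `o–u` puts `u` on `o`'s side, `u–a₁` on the roots' side. -/
theorem noPocketH1 : ¬ PocketAB.HasPocketAB endsH1 0 1 2 3 4 FH1 := by
  rintro ⟨WO, WB, hs⟩
  have hoB : (0 : Fin 9) ∉ WB := fun h => by
    rcases hs.cap 0 hs.oO h with h3 | hb
    · exact absurd h3 (by decide)
    · exact absurd hb (by decide)
  have h1O : (1 : Fin 9) ∉ WO := fun h => by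
    rcases hs.cap 1 h hs.a1B with h3 | hb
    · exact absurd h3 (by decide)
    · exact absurd hb (by decide)
  have huO : (5 : Fin 9) ∈ WO := by
    rcases hs.split 0 (zFH1 0) with w | w
    · exact (ends_mem_of_within (x := 0) (y := 5) rfl w).2
    · exact absurd (ends_mem_of_within (x := 0) (y := 5) rfl w).1 hoB
  have huB : (5 : Fin 9) ∈ WB := by
    rcases hs.split 3 (zFH1 3) with w | w
    · exact absurd (ends_mem_of_within (x := 5) (y := 1) rfl w).2 h1O
    · exact (ends_mem_of_within (x := 5) (y := 1) rfl w).1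
  rcases hs.cap 5 huO huB with h | h <;> exact absurd h (by decide)

/-- No (SEP-2) split with `a₃` on `b`'s side: `o–u` puts `u` on `o`'s side, `u–b` on `b`'s. -/
theorem noSepTwoBH1 : ¬ SepTwo.HasSepTwoB endsH1 0 1 2 3 4 FH1 := by
  rintro ⟨WO, WB, hs⟩
  have hoB : (0 : Fin 9) ∉ WB := fun h => by
    rcases hs.cap 0 hs.oO h with h1 | h2
    · exact absurd h1 (by decide)
    · exact absurd h2 (by decide)
  have hbO : (4 : Fin 9) ∉ WO := fun h => by
    rcases hs.cap 4 h hs.bB with h1 | h2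
    · exact absurd h1 (by decide)
    · exact absurd h2 (by decide)
  have huO : (5 : Fin 9) ∈ WO := by
    rcases hs.split 0 (zFH1 0) with w | w
    · exact (ends_mem_of_within (x := 0) (y := 5) rfl w).2
    · exact absurd (ends_mem_of_within (x := 0) (y := 5) rfl w).1 hoB
  have huB : (5 : Fin 9) ∈ WB := by
    rcases hs.split 4 (zFH1 4) with w | w
    · exact absurd (ends_mem_of_within (x := 5) (y := 4) rfl w).2 hbO
    · exact (ends_mem_of_within (x := 5) (y := 4) rfl w).1
  rcases hs.cap 5 huO huB with h | h <;> exact absurd h (by decide)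

/-- No (SEP-2) split with `a₃` on `o`'s side: the same two edges. -/
theorem noSepTwoOH1 : ¬ SepTwo.HasSepTwoO endsH1 0 1 2 3 4 FH1 := by
  rintro ⟨WO, WB, hs⟩
  have hoB : (0 : Fin 9) ∉ WB := fun h => by
    rcases hs.cap 0 hs.oO h with h1 | h2
    · exact absurd h1 (by decide)
    · exact absurd h2 (by decide)
  have hbO : (4 : Fin 9) ∉ WO := fun h => by
    rcases hs.cap 4 h hs.bB with h1 | h2
    · exact absurd h1 (by decide)
    · exact absurd h2 (by decide)
  have huO : (5 : Fin 9) ∈ WO := by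
    rcases hs.split 0 (zFH1 0) with w | w
    · exact (ends_mem_of_within (x := 0) (y := 5) rfl w).2
    · exact absurd (ends_mem_of_within (x := 0) (y := 5) rfl w).1 hoB
  have huB : (5 : Fin 9) ∈ WB := by
    rcases hs.split 4 (zFH1 4) with w | w
    · exact absurd (ends_mem_of_within (x := 5) (y := 4) rfl w).2 hbO
    · exact (ends_mem_of_within (x := 5) (y := 4) rfl w).1
  rcases hs.cap 5 huO huB with h | h <;> exact absurd h (by decide)

/-- No (SEP-2) separator at all. -/
theorem noSepTwoH1 : ¬ SepTwo.HasSepTwo endsH1 0 1 2 3 4 FH1 := fun h =>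
  h.elim noSepTwoBH1 noSepTwoOH1

/-! ## The assembly -/

/-- The fourteen conditions. -/
theorem instanceH1_mem14 : ResidualCoreNHatCTBRASUDO7S endsH1 0 1 2 3 4 FH1 :=
  ⟨instanceH1_mem12, noSepThreeH1, noSepThreeMirrorH1⟩

/-- The fifteen conditions. -/
theorem instanceH1_mem15 : ResidualCoreNHatCTBRASUDO7SP endsH1 0 1 2 3 4 FH1 :=
  ⟨instanceH1_mem14, noPocketH1⟩

/-- **p3 g7's (HARRIS-1) instance lies in the sixteen-condition domain of record**: the o-pocket
class on the doors `{a₁, b}` meets `ResidualCoreNHatCTBRASUDO7SP2`. -/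
theorem instanceH1_mem : ResidualCoreNHatCTBRASUDO7SP2 endsH1 0 1 2 3 4 FH1 :=
  ⟨instanceH1_mem15, noSepTwoH1⟩

end NonVacuityH1

end TypedRed

end CovForm

end Summit.Ventures.PercRepro2
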